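import Literature.MathematicalPhysics.QuantumManyBody.JelliumCrossBlockBounds
import HarnessLib

/-!
# The pair term through the condensate: the 16-block expansion (Lieb–Solovej §5, first quantized)

Topic `Literature/MathematicalPhysics/QuantumManyBody` (the charged Bose gas, `JelliumBoseGas.foldyLaw`).
[LiebSolovej2001, §5] expands the two-body term `∑_{i<j}w(xᵢ,xⱼ) = ½∑ŵ_{pq,μν}a*_pa*_qa_νa_μ` and
sorts the coefficients by which indices vanish (Lemmas 5.2–5.6). In first quantization this is the
insertion of `1 = Pᵢ + Qᵢ` and `1 = Pⱼ + Qⱼ` on both sides of `w(xᵢ,xⱼ)`: with the four pieces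

`Ψ = PᵢPⱼΨ + PᵢQⱼΨ + QᵢPⱼΨ + QᵢQⱼΨ`   (`condensatePieces ℓ i j Ψ = ![PᵢPⱼΨ, PᵢQⱼΨ, QᵢPⱼΨ, QᵢQⱼΨ]`),

`∫_{Λⁿ} w(xᵢ,xⱼ)|Ψ|² = ∑_{α,β=0}^{3} ∫_{Λⁿ} w(xᵢ,xⱼ) Re( conj(piece_α) piece_β )`   (`pair_expansion`).

The blocks are consumed by the landed estimates: `(0,0)` ↔ `ŵ_{00,00}` (`JelliumLemma52.pairPP_eq`),
`(1,1),(2,2)` ↔ `ŵ_{p0,q0}` (`JelliumLemma53`), `(1,2),(2,1)` ↔ `ŵ_{p0,0q}` exchange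
(`JelliumExchangeBound`), `(0,3),(3,0)` ↔ `ŵ_{pq,00}` pairing (kept for §6), one index `3` with one
of `1,2` ↔ `ŵ_{pq,m0}` (`JelliumCrossBlockBounds.threeQ_blocks_le`), `(0,1),(0,2),…` ↔ `ŵ_{p0,00}`
(Lemma 5.5), `(3,3)` ↔ `ŵ_{pq,μν} ≥ 0`.

* `condensatePieces` (def) and `sum_condensatePieces` — `Ψ = ∑_α piece_α` pointwise;
* `norm_sq_sum_eq` — `|∑_α z_α|² = ∑_{α,β} Re(z̄_α z_β)`;
* `pair_expansion` — the 16-block identity for a bounded measurable real weight and continuous `Ψ`.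

## References

* [LiebSolovej2001] E. H. Lieb, J. P. Solovej, Commun. Math. Phys. 217 (2001) 127–163, §5
  (arXiv:cond-mat/0007425, pp. 11–13).
-/

noncomputable section

open MeasureTheory Set Filter Real
open scoped ENNReal NNReal Topology ComplexConjugate

namespace Literature.MathematicalPhysics.QuantumManyBody.JelliumBoseGas

open BoseGas

variable {n : ℕ}

/-- **The four condensate pieces** of an `n`-body function in the variables `i, j`:
`![PᵢPⱼΨ, PᵢQⱼΨ, QᵢPⱼΨ, QᵢQⱼΨ]`. [cite: LiebSolovej2001, §5] -/
def condensatePieces (ℓ : ℝ) (i j : Fin n) (Ψ : Config n → ℂ) : Fin 4 → Config n → ℂ :=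
  ![sliceMean ℓ i (sliceMean ℓ j Ψ), sliceMean ℓ i (sliceFluct ℓ j Ψ),
    sliceFluct ℓ i (sliceMean ℓ j Ψ), sliceFluct ℓ i (sliceFluct ℓ j Ψ)]

section Pieces

variable (ℓ : ℝ) (i j : Fin n) (Ψ : Config n → ℂ)

/-- Piece `0` is `PᵢPⱼΨ`. [folklore] -/
@[simp] theorem condensatePieces_zero : condensatePieces ℓ i j Ψ 0 = sliceMean ℓ i (sliceMean ℓ j Ψ) := rfl

/-- Piece `1` is `PᵢQⱼΨ`. [folklore] -/
@[simp] theorem condensatePieces_one : condensatePieces ℓ i j Ψ 1 = sliceMean ℓ i (sliceFluct ℓ j Ψ) := rfl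

/-- Piece `2` is `QᵢPⱼΨ`. [folklore] -/
@[simp] theorem condensatePieces_two : condensatePieces ℓ i j Ψ 2 = sliceFluct ℓ i (sliceMean ℓ j Ψ) := rfl

/-- Piece `3` is `QᵢQⱼΨ`. [folklore] -/
@[simp] theorem condensatePieces_three : condensatePieces ℓ i j Ψ 3 = sliceFluct ℓ i (sliceFluct ℓ j Ψ) := rfl

/-- **`Ψ = PᵢPⱼΨ + PᵢQⱼΨ + QᵢPⱼΨ + QᵢQⱼΨ`** pointwise (pure algebra: `P + Q = 1` twice).
[cite: LiebSolovej2001, §5] -/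
theorem sum_condensatePieces (X : Config n) : ∑ α : Fin 4, condensatePieces ℓ i j Ψ α X = Ψ X := by
  rw [Fin.sum_univ_four, condensatePieces_zero, condensatePieces_one, condensatePieces_two,
    condensatePieces_three]
  have h1 : sliceMean ℓ i (sliceMean ℓ j Ψ) X + sliceFluct ℓ i (sliceMean ℓ j Ψ) X = sliceMean ℓ j Ψ X :=
    sliceMean_add_sliceFluct ℓ i _ X
  have h2 : sliceMean ℓ i (sliceFluct ℓ j Ψ) X + sliceFluct ℓ i (sliceFluct ℓ j Ψ) X = sliceFluct ℓ j Ψ X :=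
    sliceMean_add_sliceFluct ℓ i _ X
  have h3 : sliceMean ℓ j Ψ X + sliceFluct ℓ j Ψ X = Ψ X := sliceMean_add_sliceFluct ℓ j Ψ X
  linear_combination h1 + h2 + h3

/-- The pieces are continuous for continuous `Ψ`. [folklore] -/
theorem continuous_condensatePieces {Ψ : Config n → ℂ} (hΨ : Continuous Ψ) (α : Fin 4) :
    Continuous (condensatePieces ℓ i j Ψ α) := by
  fin_cases α
  · exact continuous_sliceMean ℓ i (continuous_sliceMean ℓ j hΨ)
  · exact continuous_sliceMean ℓ i (continuous_sliceFluct ℓ j hΨ)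
  · exact continuous_sliceFluct ℓ i (continuous_sliceMean ℓ j hΨ)
  · exact continuous_sliceFluct ℓ i (continuous_sliceFluct ℓ j hΨ)

end Pieces

/-- **`|∑_α z_α|² = ∑_{α,β} Re(z̄_α z_β)`** for a finite family of complex numbers. [folklore] -/
theorem norm_sq_sum_eq {ι : Type*} (s : Finset ι) (z : ι → ℂ) :
    ‖∑ α ∈ s, z α‖ ^ 2 = ∑ α ∈ s, ∑ β ∈ s, (conj (z α) * z β).re := by
  set S : ℂ := ∑ α ∈ s, z α with hS
  have h : Complex.normSq S = (conj S * S).re := by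
    have e := Complex.normSq_eq_conj_mul_self (z := S)
    rw [← e, Complex.ofReal_re]
  rw [← Complex.normSq_eq_norm_sq, h, hS, map_sum, Finset.sum_mul_sum, Complex.re_sum]
  exact Finset.sum_congr rfl fun α _ => Complex.re_sum _ _

/-! ### The expansion -/

/-- A bounded measurable function is integrable on `cellN`. [folklore] -/
theorem integrableOn_cellN_of_bounded {ℓ : ℝ} {f : Config n → ℝ} (hf : Measurable f) {C : ℝ}
    (hC : ∀ X ∈ cellN n ℓ, ‖f X‖ ≤ C) : IntegrableOn f (cellN n ℓ) := by
  refine Measure.integrableOn_of_bounded (M := C) ?_ hf.aestronglyMeasurable ?_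
  · rw [volume_cellN]; exact ENNReal.pow_ne_top (ENNReal.pow_ne_top ENNReal.ofReal_ne_top)
  · exact (ae_restrict_iff' (measurableSet_cellN n ℓ)).2 (Eventually.of_forall hC)

/-- **The 16-block expansion of the pair term** [LiebSolovej2001, §5]: for `ℓ > 0`, a jointly
measurable bounded real weight `w`, particles `i, j`, and a continuous `n`-body function `Ψ`,
`∫_{Λⁿ} w(xᵢ,xⱼ)|Ψ|² = ∑_{α,β} ∫_{Λⁿ} w(xᵢ,xⱼ) Re(conj(piece_α) piece_β)` with the pieces
`![PᵢPⱼΨ, PᵢQⱼΨ, QᵢPⱼΨ, QᵢQⱼΨ]`. [cite: LiebSolovej2001, §5] -/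
theorem pair_expansion {ℓ : ℝ} {w : Space → Space → ℝ} (hw : Measurable (Function.uncurry w))
    {Wb : ℝ} (hWb : ∀ x y, |w x y| ≤ Wb) (i j : Fin n) {Ψ : Config n → ℂ} (hΨ : Continuous Ψ) :
    ∫ X in cellN n ℓ, w (X i) (X j) * ‖Ψ X‖ ^ 2 =
      ∑ α : Fin 4, ∑ β : Fin 4, ∫ X in cellN n ℓ,
        w (X i) (X j) * (conj (condensatePieces ℓ i j Ψ α X) * condensatePieces ℓ i j Ψ β X).re := by
  set pc := condensatePieces ℓ i j Ψ with hpc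
  have hwij : Measurable fun X : Config n => w (X i) (X j) := by
    have e : (fun X : Config n => w (X i) (X j)) = Function.uncurry w ∘ fun X : Config n => (X i, X j) := rfl
    rw [e]; exact hw.comp (by fun_prop)
  -- pointwise identity
  have hpt : ∀ X, w (X i) (X j) * ‖Ψ X‖ ^ 2 =
      ∑ α : Fin 4, ∑ β : Fin 4, w (X i) (X j) * (conj (pc α X) * pc β X).re := by
    intro X
    rw [← sum_condensatePieces ℓ i j Ψ X, norm_sq_sum_eq, Finset.mul_sum]
    exact Finset.sum_congr rfl fun α _ => Finset.mul_sum _ _ _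
  -- bounds for the pieces on the closed cube
  have hb : ∀ α : Fin 4, ∃ C : ℝ, 0 ≤ C ∧ ∀ X ∈ cellN n ℓ, ‖pc α X‖ ≤ C := by
    intro α
    obtain ⟨C, hC⟩ := (isCompact_closedCubeN n ℓ).exists_bound_of_continuousOn
      (continuous_condensatePieces ℓ i j hΨ α).continuousOn
    refine ⟨max C 0, le_max_right _ _, fun X hX => (hC X (cellN_subset_closedCubeN n ℓ hX)).trans (le_max_left _ _)⟩
  choose C hC0 hC using hb
  have hWb0 : 0 ≤ Wb := (abs_nonneg _).trans (hWb 0 0)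
  -- integrability of each block
  have hI : ∀ α β : Fin 4, IntegrableOn (fun X => w (X i) (X j) * (conj (pc α X) * pc β X).re) (cellN n ℓ) := by
    intro α β
    have hm : Measurable fun X => w (X i) (X j) * (conj (pc α X) * pc β X).re :=
      hwij.mul (Complex.measurable_re.comp
        ((Complex.continuous_conj.measurable.comp (continuous_condensatePieces ℓ i j hΨ α).measurable).mul
          (continuous_condensatePieces ℓ i j hΨ β).measurable))
    refine integrableOn_cellN_of_bounded hm (C := Wb * (C α * C β)) (fun X hX => ?_)
    rw [Real.norm_eq_abs, abs_mul]
    refine mul_le_mul (hWb _ _) ?_ (abs_nonneg _) hWb0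
    calc |(conj (pc α X) * pc β X).re| ≤ ‖conj (pc α X) * pc β X‖ := Complex.abs_re_le_norm _
      _ = ‖pc α X‖ * ‖pc β X‖ := by rw [norm_mul, Complex.norm_conj]
      _ ≤ C α * C β := mul_le_mul (hC α X hX) (hC β X hX) (norm_nonneg _) (hC0 α)
  -- integrate
  simp_rw [hpt]
  rw [integral_finsetSum _ fun α _ => integrable_finsetSum _ fun β _ => hI α β]
  exact Finset.sum_congr rfl fun α _ => integral_finsetSum _ fun β _ => hI α β

end Literature.MathematicalPhysics.QuantumManyBody.JelliumBoseGas
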